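import Summits.Ventures.GridStability.Lyapunov.StructurePreservingPolytopeRoa
import Summits.Ventures.GridStability.Models.ClassicalSwing
import HarnessLib

/-!
# GridStability/Lyapunov/ClassicalSwingPolytopeRoa — the network-reduced classical model with
# NON-UNIFORM damping and ANY lossless coupling graph on Vu–Turitsyn's polytope: the solver-free,
# inverse-free synchronisation region `{𝒫, momentum leaf, V ≤ c}`, `c < min C_ij·vtGap(δˢ_ij)`
# (the `gen = univ` reading of `vtSublevel_subset_regionOfAttraction`, in model-1's vocabulary)

Cell `gridfusion` (LADDER-GRIDFUSION), seat gridfusion-lyap-1 (g6); lead RULINGs 6i (5) / 6j (1)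
«LFF-NU-SPARSE» («the generic non-uniform-damping layer re-packaged for a SPARSE line set … a
solver-free synchronisation-region theorem») and 6o (1) (the repair «SP-POLYTOPE», ★ #91). ★ #91's
generic theorem `Lyapunov.StructurePreserving.vtSublevel_subset_regionOfAttraction` (p533955) is stated
for model-2's MIXED-ORDER class `StructurePreserving.Params`; with `gen = univ` (every node a machine)
that class IS the network-reduced classical model without an infinite bus. THIS FILE performs that
reading BY NAME for model-1's typed object `Models.ClassicalSwing` (Anderson–Fouad (2.56) / Sauer–Pai
(7.215)–(7.216), [cite: SauerPai1998, §7.9.3 eqs. (7.212)–(7.216)]) and its solution notion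
`ClassicalSwing.IsSolutionOn γ univ` — so that every typed lossless instance (`RecastData.toModel`,
any `n`, any damping vector, any symmetric susceptance pattern `B_ij ≥ 0`, sparse or dense) gets the
polytope sentence with an EXPLICIT closed-form level, where the LFF layer on Pai's machine-reference
space (`RelativeLffNonUniformRoa.synchronisation_of_state`, p526132; rider «#80′») gives an existential
one and needs `Ñ⁻¹` and rank-one level facts:

* `spParams p` — `M_cl` AS structure-preserving data with `gen = univ`: `M`, `D`, net powers
  `P⁰_i = P_i − E_i²G_ii`, couplings `b_ij = C_ij = E_iE_jB_ij` off the diagonal (`0` on it);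
  `spParams_wellFormed` (`M, D > 0`, `B` symmetric), `spParams_pe`, `P_sub_Pe` (lossless:
  `P_i − P_ei(δ) = P⁰_i − f_i(δ)`), `sum_P0_eq_zero` / `syncFreq_eq_zero` / `Pbar_eq` (an equilibrium
  exists ⇒ `Σ P⁰ = 0`, `ω₀ = 0`, `P̄ = P⁰`), `isSyncEquilibrium_of_isEquilibrium`;
* `phaseField_spParams` — **the two vector fields coincide**: `phaseField (spParams p) = p.field`
  (lossless, `B` symmetric, an equilibrium exists); `hasDerivWithinAt_of_isSolutionOn` — every
  `M_cl`-solution on `univ` is a solution of the phase field on every `[0, T]`;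
* `polytope_synchronisation` — **THE SENTENCE** (three columns below): `M_i, D_i > 0` (damping
  pattern ARBITRARY), `B` symmetric, lossless (`G_ij = 0`, `i ≠ j`), `C_ij ≥ 0` off the diagonal,
  PRECONNECTED coupling graph `{C_ij ≠ 0}`, an equilibrium `δˢ` with `|δˢ_i − δˢ_j| < π/2` on coupled
  pairs, a level `c < C_ij·vtGap(δˢ_i − δˢ_j)` on coupled pairs: every solution `γ = (δ, ω)` of `M_cl`
  on `univ` starting with all coupled line angles in the polytope `|(δ_i − δ_j) + (δˢ_i − δˢ_j)| < π`,
  on the momentum leaf `Σ M_iω_i + Σ D_iδ_i = Σ D_iδˢ_i`, with energy `V ≤ c`, keeps the polytope and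
  `V ≤ c` for all `t ≥ 0` and tends to `(δˢ, 0)` — ALL speed deviations `→ 0`, ALL rotor angles
  `→ δˢ` (absolute angles: the leaf fixes the rotation); `equilibrium_mem` (the rest state is in the
  set, `V(δˢ, 0) = 0`).

THREE COLUMNS. CERTIFIED (kernel): the statements below about MODEL MV-2L = lossless network-reduced
classical model with per-machine damping (`plan/MODEL-VALIDITY.md`; NO uniform-λ hypothesis, NO
infinite bus) and CLASS = the well `{𝒫, leaf, V ≤ c}`; inner estimate; no SDP, no Gram certificate, no
matrix inverse. VALIDATED: nothing. No sentence here says that any grid is stable. One definition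
(`spParams`, bookkeeping: the same numbers read as `Params`); no named fact; standard axioms.
-/

noncomputable section

open Set Filter Topology Real Finset
open Summit.Ventures.GridStability.Models
open Summit.Ventures.GridStability.Models.StructurePreserving
open Summit.Ventures.GridStability.Models.StructurePreserving.Params
open Summit.Ventures.GridStability.Lyapunov.StructurePreserving
open Literature.MathematicalPhysics.PowerSystems.ClassicalModel.LosslessSystem (vtGap)

namespace Summit.Ventures.GridStability.Lyapunov.ClassicalSwingPolytope

variable {n : ℕ} (p : ClassicalSwing n)

/-! ### The classical model as structure-preserving data with `gen = univ` -/

/-- **`M_cl` read as structure-preserving data with every node a machine** (`gen = univ`): inertias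
`M_i`, dampings `D_i`, net powers `P⁰_i = P_i − E_i²G_ii` (the constant-impedance self term moved to
the left, Sauer–Pai `P_i′`), couplings `b_ij = C_ij = E_iE_jB_ij` for `i ≠ j` and `0` on the diagonal
(the self-susceptance never couples). Bookkeeping only: the same numbers.
[cite: SauerPai1998, §7.9.3 eqs. (7.212)–(7.216); Padiyar2013, §3.2 eq (3.2)] -/
def spParams : Params n where
  M := p.M
  D := p.D
  P0 := fun i => p.P i - p.E i ^ 2 * p.G i i
  b := fun i j => if i = j then 0 else p.Ccoef i j
  gen := Finset.univ

/-- The couplings of `spParams p`: `C_ij` off the diagonal, `0` on it. -/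
theorem spParams_b (i j : Fin n) : (spParams p).b i j = if i = j then 0 else p.Ccoef i j := rfl

/-- Off the diagonal the coupling is `C_ij`. -/
theorem spParams_b_of_ne {i j : Fin n} (h : i ≠ j) : (spParams p).b i j = p.Ccoef i j := by
  rw [spParams_b, if_neg h]

/-- A nonzero coupling is off-diagonal with `C_ij ≠ 0`. -/
theorem ne_of_spParams_b_ne_zero {i j : Fin n} (h : (spParams p).b i j ≠ 0) :
    i ≠ j ∧ p.Ccoef i j ≠ 0 := by
  by_cases hij : i = j
  · exact absurd (by rw [spParams_b, if_pos hij]) h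
  · exact ⟨hij, by rwa [spParams_b_of_ne p hij] at h⟩

/-- Every node is a machine. -/
theorem mem_spParams_gen (i : Fin n) : i ∈ (spParams p).gen := Finset.mem_univ i

/-- `C` is symmetric when `B` is. -/
theorem Ccoef_symm (hBs : ∀ i j, p.B i j = p.B j i) (i j : Fin n) : p.Ccoef j i = p.Ccoef i j := by
  unfold ClassicalSwing.Ccoef
  rw [hBs j i]; ring

/-- The couplings of `spParams p` are symmetric when `B` is. -/
theorem spParams_b_symm (hBs : ∀ i j, p.B i j = p.B j i) (i j : Fin n) :
    (spParams p).b i j = (spParams p).b j i := by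
  by_cases h : i = j
  · subst h; rfl
  · rw [spParams_b_of_ne p h, spParams_b_of_ne p (Ne.symm h), Ccoef_symm p hBs]

/-- **Well-formedness**: `M_i, D_i > 0` at every node (all nodes are machines) and `B` symmetric.
[cite: SauerPai1998, §7.9.3 eqs. (7.215)–(7.216)] -/
theorem spParams_wellFormed (hM : ∀ i, 0 < p.M i) (hD : ∀ i, 0 < p.D i)
    (hBs : ∀ i j, p.B i j = p.B j i) : (spParams p).WellFormed where
  M_pos := fun i _ => hM i
  M_eq_zero := fun i hi => absurd (mem_spParams_gen p i) hi
  D_pos := hD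
  b_symm := spParams_b_symm p hBs

/-- The structure-preserving injection of `spParams p` is the lossless coupling sum
`f_i(δ) = Σ_{j ≠ i} C_ij sin(δ_i − δ_j)`. [cite: SauerPai1998, §7.9.3 eq. (7.212)] -/
theorem spParams_pe (δ : Fin n → ℝ) (i : Fin n) :
    (spParams p).pe δ i = ∑ j ∈ univ.erase i, p.Ccoef i j * Real.sin (δ i - δ j) := by
  rw [Params.pe_eq_sum_erase]
  refine Finset.sum_congr rfl fun j hj => ?_
  rw [spParams_b_of_ne p (Finset.ne_of_mem_erase hj).symm]

/-- **Lossless electrical power**: `P_i − P_ei(δ) = P⁰_i − f_i(δ)` (the transfer-conductance terms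
`D_ij cos δ_ij` vanish). [cite: SauerPai1998, §7.9.3 eq. (7.212)] -/
theorem P_sub_Pe (hG : p.IsLossless) (δ : Fin n → ℝ) (i : Fin n) :
    p.P i - p.Pe δ i = (spParams p).P0 i - (spParams p).pe δ i := by
  have hPe : p.Pe δ i = p.E i ^ 2 * p.G i i + ∑ j ∈ univ.erase i, p.Ccoef i j * Real.sin (δ i - δ j) := by
    unfold ClassicalSwing.Pe
    congr 1
    refine Finset.sum_congr rfl fun j hj => ?_
    have hD : p.Dcoef i j = 0 := by
      unfold ClassicalSwing.Dcoef
      rw [hG i j (Finset.ne_of_mem_erase hj).symm, mul_zero]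
    rw [hD, zero_mul, add_zero]
  rw [hPe, spParams_pe]
  show p.P i - (p.E i ^ 2 * p.G i i + _) = (p.P i - p.E i ^ 2 * p.G i i) - _
  ring

/-- At an equilibrium `δˢ` of `M_cl` (`P_ei(δˢ) = P_i`) the net powers are the injections:
`P⁰_i = f_i(δˢ)`. -/
theorem P0_eq_pe_of_isEquilibrium (hG : p.IsLossless) {δs : Fin n → ℝ} (hδs : p.IsEquilibrium δs)
    (i : Fin n) : (spParams p).P0 i = (spParams p).pe δs i := by
  have h := P_sub_Pe p hG δs i
  rw [hδs i, sub_self] at h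
  linarith

/-- **An equilibrium makes the net powers balanced**: `Σ_i P⁰_i = 0` (losslessness of the
injections). -/
theorem sum_P0_eq_zero (hBs : ∀ i j, p.B i j = p.B j i) (hG : p.IsLossless) {δs : Fin n → ℝ}
    (hδs : p.IsEquilibrium δs) : ∑ i, (spParams p).P0 i = 0 := by
  rw [Finset.sum_congr rfl fun i _ => P0_eq_pe_of_isEquilibrium p hG hδs i]
  exact (spParams p).sum_pe_eq_zero (spParams_b_symm p hBs) δs

/-- Hence the synchronous frequency deviation of `spParams p` vanishes (the frame of `M_cl` IS the
synchronous frame). -/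
theorem syncFreq_eq_zero (hBs : ∀ i j, p.B i j = p.B j i) (hG : p.IsLossless) {δs : Fin n → ℝ}
    (hδs : p.IsEquilibrium δs) : (spParams p).syncFreq = 0 := by
  unfold Params.syncFreq
  rw [sum_P0_eq_zero p hBs hG hδs, zero_div]

/-- … and the shifted powers are the net powers, `P̄ = P⁰`. -/
theorem Pbar_eq (hBs : ∀ i j, p.B i j = p.B j i) (hG : p.IsLossless) {δs : Fin n → ℝ}
    (hδs : p.IsEquilibrium δs) (i : Fin n) : (spParams p).Pbar i = (spParams p).P0 i := by
  unfold Params.Pbar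
  rw [syncFreq_eq_zero p hBs hG hδs, mul_zero, sub_zero]

/-- An equilibrium of `M_cl` is a synchronous equilibrium of `spParams p`. -/
theorem isSyncEquilibrium_of_isEquilibrium (hBs : ∀ i j, p.B i j = p.B j i) (hG : p.IsLossless)
    {δs : Fin n → ℝ} (hδs : p.IsEquilibrium δs) : (spParams p).IsSyncEquilibrium δs := fun i => by
  rw [Pbar_eq p hBs hG hδs i, P0_eq_pe_of_isEquilibrium p hG hδs i]

/-! ### The two vector fields coincide; solutions transfer -/

/-- **`phaseField (spParams p) = p.field`** for lossless symmetric data with an equilibrium: at every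
node `δ̇_i = ω_i` and `ω̇_i = (P̄_i − D_iω_i − f_i(δ))/M_i = (P_i − P_ei(δ) − D_iω_i)/M_i`.
[cite: SauerPai1998, §7.9.3 eqs. (7.215)–(7.216); Padiyar2013, §3.2 eq (3.2)] -/
theorem phaseField_spParams (hBs : ∀ i j, p.B i j = p.B j i) (hG : p.IsLossless)
    {δs : Fin n → ℝ} (hδs : p.IsEquilibrium δs) (x : ClassicalSwing.State n) :
    phaseField (spParams p) x = p.field x := by
  refine Prod.ext (funext fun i => ?_) (funext fun i => ?_)
  · rw [phaseField_fst_of_mem (spParams p) x (mem_spParams_gen p i)]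
    rfl
  · rw [phaseField_snd_of_mem (spParams p) x (mem_spParams_gen p i), Pbar_eq p hBs hG hδs i]
    show ((spParams p).P0 i - p.D i * x.2 i - (spParams p).pe x.1 i) / p.M i
      = (p.P i - p.Pe x.1 i - p.D i * x.2 i) / p.M i
    rw [P_sub_Pe p hG x.1 i]
    ring

/-- **Solutions of `M_cl` are solutions of the phase field** (on every `[0, T]`, tree convention).
-/
theorem hasDerivWithinAt_of_isSolutionOn (hBs : ∀ i j, p.B i j = p.B j i) (hG : p.IsLossless)
    {δs : Fin n → ℝ} (hδs : p.IsEquilibrium δs) {γ : ℝ → ClassicalSwing.State n}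
    (hγ : p.IsSolutionOn γ univ) (T : ℝ) (t : ℝ) (_ht : t ∈ Icc 0 T) :
    HasDerivWithinAt γ (phaseField (spParams p) (γ t)) (Icc 0 T) t := by
  rw [phaseField_spParams p hBs hG hδs]
  exact (hγ t (mem_univ t)).mono (subset_univ _)

/-- The momentum of `spParams p` is `Σ_i M_iω_i + Σ_i D_iδ_i` (every node a machine). -/
theorem spParams_momentum (δ v : Fin n → ℝ) :
    (spParams p).momentum δ v = ∑ i, p.M i * v i + ∑ i, p.D i * δ i := rfl

/-! ### The synchronisation sentence for `M_cl` -/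

/-- **Synchronisation of the lossless network-reduced classical model with NON-UNIFORM damping from
Vu–Turitsyn's polytope, solver-free** (★ #91's theorem read with `gen = univ` on model-1's `M_cl`).
DATA: `n ≠ 0` machines, `M_i, D_i > 0` (damping pattern ARBITRARY — no uniform `D_i/M_i`), `B`
symmetric, lossless (`G_ij = 0`, `i ≠ j`), couplings `C_ij = E_iE_jB_ij ≥ 0` off the diagonal with a
PRECONNECTED coupling graph `{C_ij ≠ 0}` (sparse or dense), an equilibrium `δˢ` (`P_ei(δˢ) = P_i`) with
`|δˢ_i − δˢ_j| < π/2` on coupled pairs, and a level `c < C_ij·vtGap(δˢ_i − δˢ_j)` on coupled pairs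
(`vtGap d = 2 cos d − (π − 2|d|) sin|d|`, closed form). STATEMENT: every solution `γ = (δ, ω)` of
`M_cl` on `univ` whose initial state has every coupled line angle in the polytope
`|(δ_i − δ_j) + (δˢ_i − δˢ_j)| < π`, lies on the momentum leaf `Σ M_iω_i(0) + Σ D_iδ_i(0) = Σ D_iδˢ_i`
and has energy `V(δˢ; δ(0), ω(0)) ≤ c` (`V = ½Σ M_iω_i² + Σ_{i<j} C_ij U(δ_ij, δˢ_ij)`, the
`gen = univ` Bergen–Hill energy) keeps the polytope and `V ≤ c` for all `t ≥ 0` and converges to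
`(δˢ, 0)`: ALL speed deviations `→ 0`, ALL rotor angles `→ δˢ`. No SDP, no Gram certificate, no matrix
inverse, no rank-one fact. MODEL MV-2L; no sentence here says a grid is stable.
[cite: VuTuritsyn2016, §IV (ℛ = {x ∈ 𝒫 : V < V_min}, third construction) and Appendix 9.2–9.3; SauerPai1998, §7.9.3 eqs. (7.215)–(7.216)] -/
theorem polytope_synchronisation (hn : n ≠ 0) (hM : ∀ i, 0 < p.M i) (hD : ∀ i, 0 < p.D i)
    (hBs : ∀ i j, p.B i j = p.B j i) (hG : p.IsLossless) (hC : ∀ i j, i ≠ j → 0 ≤ p.Ccoef i j)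
    (hconn : (spParams p).couplingGraph.Preconnected) {δs : Fin n → ℝ} (hδs : p.IsEquilibrium δs)
    (h0 : ∀ i j, i ≠ j → p.Ccoef i j ≠ 0 → |δs i - δs j| < π / 2) {c : ℝ}
    (hc : ∀ i j, i ≠ j → p.Ccoef i j ≠ 0 → c < p.Ccoef i j * vtGap (δs i - δs j))
    {γ : ℝ → ClassicalSwing.State n} (hγ : p.IsSolutionOn γ univ)
    (hpol : ∀ i j, i ≠ j → p.Ccoef i j ≠ 0 → |((γ 0).1 i - (γ 0).1 j) + (δs i - δs j)| < π)
    (hL : ∑ i, p.M i * (γ 0).2 i + ∑ i, p.D i * (γ 0).1 i = ∑ i, p.D i * δs i)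
    (hV : (spParams p).energy δs (γ 0).1 (γ 0).2 ≤ c) :
    (∀ t, 0 ≤ t →
        (∀ i j, i ≠ j → p.Ccoef i j ≠ 0 → |((γ t).1 i - (γ t).1 j) + (δs i - δs j)| < π) ∧
        (spParams p).energy δs (γ t).1 (γ t).2 ≤ c) ∧
      Tendsto γ atTop (𝓝 (δs, 0)) := by
  -- hypotheses in the `Params` vocabulary
  have hp := spParams_wellFormed p hM hD hBs
  have hb : ∀ i j, 0 ≤ (spParams p).b i j := fun i j => by
    by_cases h : i = j
    · rw [spParams_b, if_pos h]
    · rw [spParams_b_of_ne p h]; exact hC i j h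
  have h0' : ∀ i j, (spParams p).b i j ≠ 0 → |δs i - δs j| < π / 2 := fun i j h =>
    let ⟨hij, hC0⟩ := ne_of_spParams_b_ne_zero p h
    h0 i j hij hC0
  have hc' : ∀ i j, (spParams p).b i j ≠ 0 → c < (spParams p).b i j * vtGap (δs i - δs j) :=
    fun i j h => by
      obtain ⟨hij, hC0⟩ := ne_of_spParams_b_ne_zero p h
      rw [spParams_b_of_ne p hij]
      exact hc i j hij hC0
  have hy : γ 0 ∈ vtPolytope (spParams p) δs ∩ constraintSet (spParams p) δs ∧
      phaseEnergy (spParams p) δs (γ 0) ≤ c := by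
    refine ⟨⟨fun i j h => ?_, ?_, fun i hi => absurd (mem_spParams_gen p i) hi⟩, hV⟩
    · obtain ⟨hij, hC0⟩ := ne_of_spParams_b_ne_zero p h
      exact hpol i j hij hC0
    · show (spParams p).momentum (γ 0).1 (γ 0).2 = (spParams p).momentum δs 0
      rw [spParams_momentum, spParams_momentum, hL]
      simp
  obtain ⟨-, hall⟩ := vtSublevel_subset_regionOfAttraction hp hn hconn hb h0'
    (isSyncEquilibrium_of_isEquilibrium p hBs hG hδs) hc' hy
  obtain ⟨hstay, hlim⟩ := hall γ rfl fun T t ht => hasDerivWithinAt_of_isSolutionOn p hBs hG hδs hγ T t ht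
  refine ⟨fun t ht => ⟨fun i j hij hC0 => ?_, (hstay t ht).2⟩, hlim⟩
  have hbij : (spParams p).b i j ≠ 0 := by rw [spParams_b_of_ne p hij]; exact hC0
  exact (hstay t ht).1.1 i j hbij

/-- **The rest state is certified**: `(δˢ, 0)` has every coupled line angle in the polytope, lies on
the leaf, and `V(δˢ, 0) = 0`. [folklore] -/
theorem equilibrium_mem (p : ClassicalSwing n) {δs : Fin n → ℝ}
    (h0 : ∀ i j, i ≠ j → p.Ccoef i j ≠ 0 → |δs i - δs j| < π / 2) :
    (∀ i j, i ≠ j → p.Ccoef i j ≠ 0 → |(δs i - δs j) + (δs i - δs j)| < π) ∧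
      (spParams p).energy δs δs 0 = 0 := by
  refine ⟨fun i j hij hC0 => ?_, by simp [Params.energy, Params.kinetic, Params.potential]⟩
  have h := abs_lt.1 (h0 i j hij hC0)
  rw [abs_lt]
  constructor <;> linarith [h.1, h.2]

end Summit.Ventures.GridStability.Lyapunov.ClassicalSwingPolytope

end
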